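import Mathlib.Analysis.Convex.SimplicialComplex.AffineIndependentUnion
import Literature.Analysis.Convexity.ComplexUnion
import Literature.Topology.FourManifolds.ConeComplex
import HarnessLib

/-!
# Prism complexes: the ordered (staircase) triangulation of `conv σ × [t₀, t₁]`

The standard triangulation of the prism over a simplex — for an ordered affinely independent
vertex list `l = [v₀, …, v_k]` in a finite-dimensional real normed space `W` and levels
`t₀ < t₁`, the simplices of `W × ℝ`
`R_i = {(v₀, t₁), …, (v_i, t₁), (v_i, t₀), …, (v_k, t₀)}` (`stair`), `0 ≤ i ≤ k`, and their
faces (`prismFaces`) — constructed as a **geometric simplicial complex** by the recursion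
*prism over `v :: rest` = cone from `(v, t₁)` over (bottom simplex ∪ prism over `rest`)*
(`coneComplex` of `ConeComplex.lean` over `unionComplex`), which is how every convex polytope
is the cone from one of its vertices over the complementary boundary:

* `prismFaces_cons` — the combinatorial recursion of the face family;
* `bottom_inter_prism_subset` — the bottom simplex and the prism over `rest` meet in common
  faces (the lowest level of a closed simplex is spanned by its lowest vertices,
  `mem_convexHull_filter_of_snd_eq`, and `AffineIndependent.convexHull_inter`);
* `visibleFrom_base` — the union is visible from `(v, t₁)`: bottom faces through the level
  functional `-snd`, faces over `rest` through (minus) the barycentric coordinate of `v`;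
* `exists_prismComplex` — **a geometric simplicial complex with faces `prismFaces t₀ t₁ l`**;
* `iUnion_prismFaces_eq` — **the staircase simplices fill the prism**
  `conv l × [t₀, t₁]` (`prismSet`), by ray casting from the top vertex
  (`exists_mem_base_mem_segment`).

This is the cell structure of the homotopy tracks `σ × [t_{a-1}, t_a]` in the engulfing
arguments (Rushing 1973, proofs of Thms. 4.2.1 and 4.12.1); its explicit collapse onto
`bottom ∪ walls` (prisms by decreasing dimension, cones of the collapse of the base) is what
makes the expansion order of the cells explicit without Rushing's Thm. 1.6.3.  Everything is
proved; definitions (`liftV`, `stair`, `prismFaces`, `bottomSimplex`, `simplexCx`, `prismSet`) are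
explicit (the empty complex is Mathlib's `⊥`, the level functional Mathlib's `AffineMap.snd`);
no named facts.

## References

* C. P. Rourke, B. J. Sanderson, *Introduction to Piecewise-Linear Topology*, Springer (1972),
  Ch. 2 (cells, cones; the prism `σ × I` as a cell complex). [RourkeSanderson1972]
* T. B. Rushing, *Topological Embeddings*, Academic Press (1973), §1.6.B and the proofs of
  Thm. 4.2.1 (the track `Δ × I`) and Thm. 4.12.1 (the cells `σ × [t_{a-1}, t_a]`). [Rushing1973]
-/

open Set Function

noncomputable section

namespace Literature.Topology.FourManifolds

open Literature.Analysis.Convexity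

/-! ## Prism complexes: the ordered (staircase) triangulation of `conv σ × [t₀, t₁]` -/

section PrismComb

variable {W : Type*}

/-- The copy `(v, t)` of a vertex at the level `t`. [folklore] -/
def liftV (t : ℝ) (v : W) : W × ℝ := (v, t)

/-- Auxiliary (`liftV_fst`). [folklore] -/
@[simp] theorem liftV_fst (t : ℝ) (v : W) : (liftV t v).1 = v := rfl

/-- Auxiliary (`liftV_snd`). [folklore] -/
@[simp] theorem liftV_snd (t : ℝ) (v : W) : (liftV t v).2 = t := rfl

/-- `liftV t` is injective. [folklore] -/
theorem liftV_injective (t : ℝ) : Function.Injective (liftV (W := W) t) := fun _ _ h =>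
  congrArg Prod.fst h

/-- Lifts at different levels differ. [folklore] -/
theorem liftV_ne_liftV {t t' : ℝ} (h : t ≠ t') (v w : W) : liftV t v ≠ liftV t' w := fun he =>
  h (congrArg Prod.snd he)

variable [DecidableEq W]

/-- **The staircase simplices** of the prism over the ordered vertex list `l` between the
levels `t₀ < t₁`: `R_i = {(v₀, t₁), …, (v_i, t₁), (v_i, t₀), …, (v_k, t₀)}` (tops of the first
`i + 1` vertices, bottoms from the `i`-th on). [folklore] -/
def stair (t₀ t₁ : ℝ) (l : List W) (i : ℕ) : Finset (W × ℝ) :=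
  ((l.take (i + 1)).map (liftV t₁)).toFinset ∪ ((l.drop i).map (liftV t₀)).toFinset

/-- **The faces of the prism complex**: nonempty subsets of the staircase simplices.
[folklore] -/
def prismFaces (t₀ t₁ : ℝ) (l : List W) : Set (Finset (W × ℝ)) :=
  {F | F.Nonempty ∧ ∃ i, i < l.length ∧ F ⊆ stair t₀ t₁ l i}

/-- The bottom simplex of the prism: all bottom copies. [folklore] -/
def bottomSimplex (t₀ : ℝ) (l : List W) : Finset (W × ℝ) := (l.map (liftV t₀)).toFinset

variable {t₀ t₁ : ℝ}

/-- Auxiliary (`mem_bottomSimplex`). [folklore] -/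
theorem mem_bottomSimplex {l : List W} {p : W × ℝ} :
    p ∈ bottomSimplex t₀ l ↔ ∃ v ∈ l, liftV t₀ v = p := by
  simp [bottomSimplex]

/-- The first staircase simplex of `v :: rest` is the cone from `(v, t₁)` over the bottom
simplex. [folklore] -/
theorem stair_cons_zero (v : W) (rest : List W) :
    stair t₀ t₁ (v :: rest) 0 = insert (liftV t₁ v) (bottomSimplex t₀ (v :: rest)) := by
  simp [stair, bottomSimplex]
  exact Finset.insert_comm _ _ _

/-- The later staircase simplices of `v :: rest` are the cones from `(v, t₁)` over the staircase
simplices of `rest`. [folklore] -/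
theorem stair_cons_succ (v : W) (rest : List W) (j : ℕ) :
    stair t₀ t₁ (v :: rest) (j + 1) = insert (liftV t₁ v) (stair t₀ t₁ rest j) := by
  simp [stair, Finset.insert_union]

/-- Members of the bottom simplex are bottom copies of list members. [folklore] -/
theorem snd_eq_of_mem_bottomSimplex {l : List W} {p : W × ℝ} (hp : p ∈ bottomSimplex t₀ l) :
    p.2 = t₀ := by
  obtain ⟨v, -, rfl⟩ := mem_bottomSimplex.1 hp
  rfl

/-- Vertices of staircase simplices are lifts of list members, at level `t₀` or `t₁`.
[folklore] -/
theorem exists_of_mem_stair {l : List W} {i : ℕ} {p : W × ℝ} (hp : p ∈ stair t₀ t₁ l i) :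
    ∃ v ∈ l, p = liftV t₀ v ∨ p = liftV t₁ v := by
  simp only [stair, Finset.mem_union, List.mem_toFinset, List.mem_map] at hp
  rcases hp with ⟨v, hv, rfl⟩ | ⟨v, hv, rfl⟩
  · exact ⟨v, List.mem_of_mem_take hv, Or.inr rfl⟩
  · exact ⟨v, List.mem_of_mem_drop hv, Or.inl rfl⟩

/-- **The faces of the prism over `v :: rest`**: the nonempty subsets of the bottom simplex, the
faces of the prism over `rest`, their cones from `(v, t₁)`, and the apex. [folklore] -/
theorem prismFaces_cons (ht : t₀ ≠ t₁) {v : W} {rest : List W} (hv : v ∉ rest) :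
    prismFaces t₀ t₁ (v :: rest) =
      ({F | F.Nonempty ∧ F ⊆ bottomSimplex t₀ (v :: rest)} ∪ prismFaces t₀ t₁ rest) ∪
        (insert (liftV t₁ v)) '' ({F | F.Nonempty ∧ F ⊆ bottomSimplex t₀ (v :: rest)} ∪
          prismFaces t₀ t₁ rest) ∪ {{liftV t₁ v}} := by
  set a := liftV t₁ v with ha
  -- `a` is not a vertex of the base
  have habot : a ∉ bottomSimplex t₀ (v :: rest) := fun h =>
    ht (snd_eq_of_mem_bottomSimplex h).symm
  have hastair : ∀ j, a ∉ stair t₀ t₁ rest j := fun j h => by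
    obtain ⟨w, hw, h | h⟩ := exists_of_mem_stair h
    · exact ht.symm (congrArg Prod.snd h)
    · exact hv ((liftV_injective t₁ h) ▸ hw)
  -- description of the bases of faces of `v :: rest`
  have hbase : ∀ F : Finset (W × ℝ), (∃ i, i < (v :: rest).length ∧ F ⊆ stair t₀ t₁ (v :: rest) i) ↔
      ∃ X, (X = bottomSimplex t₀ (v :: rest) ∨ ∃ j, j < rest.length ∧ X = stair t₀ t₁ rest j) ∧
        F ⊆ insert a X := by
    intro F
    constructor
    · rintro ⟨i, hi, hF⟩
      rcases i with _ | j
      · exact ⟨_, Or.inl rfl, by rwa [stair_cons_zero] at hF⟩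
      · refine ⟨_, Or.inr ⟨j, ?_, rfl⟩, by rwa [stair_cons_succ] at hF⟩
        simpa using hi
    · rintro ⟨X, hX | ⟨j, hj, rfl⟩, hF⟩
      · rw [hX] at hF
        exact ⟨0, by simp, by rwa [stair_cons_zero]⟩
      · exact ⟨j + 1, by simpa using hj, by rwa [stair_cons_succ]⟩
  have haX : ∀ X, (X = bottomSimplex t₀ (v :: rest) ∨ ∃ j, j < rest.length ∧ X = stair t₀ t₁ rest j) →
      a ∉ X := by
    rintro X (rfl | ⟨j, -, rfl⟩)
    · exact habot
    · exact hastair j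
  -- membership in the base family
  have hmemB : ∀ F : Finset (W × ℝ),
      F ∈ ({F | F.Nonempty ∧ F ⊆ bottomSimplex t₀ (v :: rest)} ∪ prismFaces t₀ t₁ rest) ↔
        F.Nonempty ∧ ∃ X, (X = bottomSimplex t₀ (v :: rest) ∨
          ∃ j, j < rest.length ∧ X = stair t₀ t₁ rest j) ∧ F ⊆ X := by
    intro F
    simp only [Set.mem_union, Set.mem_setOf_eq, prismFaces]
    constructor
    · rintro (⟨hne, hF⟩ | ⟨hne, j, hj, hF⟩)
      · exact ⟨hne, _, Or.inl rfl, hF⟩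
      · exact ⟨hne, _, Or.inr ⟨j, hj, rfl⟩, hF⟩
    · rintro ⟨hne, X, rfl | ⟨j, hj, rfl⟩, hF⟩
      · exact Or.inl ⟨hne, hF⟩
      · exact Or.inr ⟨hne, j, hj, hF⟩
  ext F
  simp only [prismFaces, Set.mem_setOf_eq, Set.mem_union, Set.mem_image, Set.mem_singleton_iff]
  rw [hbase]
  constructor
  · rintro ⟨hne, X, hX, hF⟩
    by_cases haF : a ∈ F
    · rcases (F.erase a).eq_empty_or_nonempty with h0 | hne'
      · right
        rw [← Finset.insert_erase haF, h0]; rfl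
      · left; right
        refine ⟨F.erase a, (hmemB _).2 ⟨hne', X, hX, fun p hp => ?_⟩, Finset.insert_erase haF⟩
        have hp' := Finset.mem_erase.1 hp
        exact (Finset.mem_insert.1 (hF hp'.2)).resolve_left hp'.1
    · left; left
      refine (hmemB F).2 ⟨hne, X, hX, fun p hp => ?_⟩
      exact (Finset.mem_insert.1 (hF hp)).resolve_left fun h => haF (h ▸ hp)
  · rintro ((hF | ⟨F', hF', rfl⟩) | rfl)
    · obtain ⟨hne, X, hX, hFX⟩ := (hmemB F).1 hF
      exact ⟨hne, X, hX, hFX.trans (Finset.subset_insert a X)⟩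
    · obtain ⟨hne, X, hX, hFX⟩ := (hmemB F').1 hF'
      exact ⟨Finset.insert_nonempty a F', X, hX, Finset.insert_subset_insert a hFX⟩
    · exact ⟨Finset.singleton_nonempty a, _, Or.inl rfl, by simp⟩

end PrismComb

section PrismGeom

variable {W : Type*} [NormedAddCommGroup W] [NormedSpace ℝ W]

/-- `liftV t` as an affine map. [folklore] -/
theorem exists_affineMap_liftV (t : ℝ) : ∃ f : W →ᵃ[ℝ] W × ℝ, ∀ v, f v = liftV t v :=
  ⟨(LinearMap.inl ℝ W ℝ).toAffineMap + AffineMap.const ℝ W ((0 : W), t), fun v => by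
    simp [liftV]⟩

/-- Lifting an affinely independent vertex set keeps it affinely independent. [folklore] -/
theorem affineIndependent_image_liftV [DecidableEq W] (t : ℝ) {T : Finset W}
    (hT : AffineIndependent ℝ ((↑) : T → W)) :
    AffineIndependent ℝ ((↑) : ↥(T.image (liftV t)) → W × ℝ) := by
  obtain ⟨f, hf⟩ := exists_affineMap_liftV (W := W) t
  have h1 : AffineIndependent ℝ (f ∘ ((↑) : T → W)) := hT.map' f fun v w h => by
    have := congrArg Prod.fst h; rwa [hf, hf] at this
  have h2 := h1.range
  have hrange : Set.range (f ∘ ((↑) : T → W)) = ↑(T.image (liftV t)) := by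
    ext p
    simp only [Set.mem_range, Function.comp_apply, Finset.coe_image, Set.mem_image, Finset.mem_coe,
      Subtype.exists, exists_prop, hf]
  rw [hrange] at h2
  exact h2


/-! ### The full simplex complex and the empty complex -/

/-- **The complex of all nonempty subsets of an affinely independent finite set.** [folklore] -/
def simplexCx {E : Type*} [NormedAddCommGroup E] [NormedSpace ℝ E] [DecidableEq E] (T : Finset E)
    (hT : AffineIndependent ℝ ((↑) : T → E)) : Geometry.SimplicialComplex ℝ E :=
  Geometry.SimplicialComplex.ofAffineIndependent
    ⟨{F | F.Nonempty ∧ F ⊆ T}, fun _ hF => ⟨hF.1, fun _ hGF hGne => ⟨hGne, hGF.trans hF.2⟩⟩⟩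
    (hT.mono (Set.iUnion₂_subset fun F (hF : F.Nonempty ∧ F ⊆ T) => Finset.coe_subset.2 hF.2))

/-- The faces of the full simplex complex. [folklore] -/
theorem simplexCx_faces {E : Type*} [NormedAddCommGroup E] [NormedSpace ℝ E] [DecidableEq E]
    (T : Finset E) (hT : AffineIndependent ℝ ((↑) : T → E)) :
    (simplexCx T hT).faces = {F | F.Nonempty ∧ F ⊆ T} := rfl

/-! ### Levels -/

/-- A closed simplex whose vertices have level `≥ t` has level `≥ t`. [folklore] -/
theorem le_snd_of_mem_convexHull {F : Finset (W × ℝ)} {t : ℝ} (hF : ∀ p ∈ F, t ≤ p.2) {x : W × ℝ}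
    (hx : x ∈ convexHull ℝ (F : Set (W × ℝ))) : t ≤ x.2 := by
  have hconv : Convex ℝ {p : W × ℝ | t ≤ p.2} := by
    have : {p : W × ℝ | t ≤ p.2} = (AffineMap.snd : W × ℝ →ᵃ[ℝ] ℝ) ⁻¹' Set.Ici t := by ext p; simp
    rw [this]; exact (convex_Ici t).affine_preimage _
  exact convexHull_min (fun p hp => hF p (Finset.mem_coe.1 hp)) hconv hx

/-- A closed simplex whose vertices have level `t` has level `t`. [folklore] -/
theorem snd_eq_of_mem_convexHull {F : Finset (W × ℝ)} {t : ℝ} (hF : ∀ p ∈ F, p.2 = t) {x : W × ℝ}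
    (hx : x ∈ convexHull ℝ (F : Set (W × ℝ))) : x.2 = t := by
  have hconv : Convex ℝ {p : W × ℝ | p.2 = t} := by
    have : {p : W × ℝ | p.2 = t} = (AffineMap.snd : W × ℝ →ᵃ[ℝ] ℝ) ⁻¹' {t} := by ext p; simp
    rw [this]; exact (convex_singleton t).affine_preimage _
  exact convexHull_min (fun p hp => hF p (Finset.mem_coe.1 hp)) hconv hx

/-- **The lowest level of a closed simplex is spanned by its lowest vertices**: a point of
`conv F` at the minimal level `t` of the vertices lies in the closed simplex of the vertices at
level `t`. [folklore] -/
theorem mem_convexHull_filter_of_snd_eq [DecidableEq W] {F : Finset (W × ℝ)} {t : ℝ}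
    (hF : ∀ p ∈ F, t ≤ p.2) {x : W × ℝ} (hx : x ∈ convexHull ℝ (F : Set (W × ℝ))) (hxt : x.2 = t) :
    x ∈ convexHull ℝ ((F.filter fun p => p.2 = t : Finset (W × ℝ)) : Set (W × ℝ)) := by
  obtain ⟨w, hw0, hw1, hwx⟩ := Finset.mem_convexHull'.1 hx
  -- the weights of the higher vertices vanish
  have hsum : ∑ p ∈ F, w p * (p.2 - t) = 0 := by
    have h2 : (∑ p ∈ F, w p • p).2 = ∑ p ∈ F, w p * p.2 := by
      rw [Prod.snd_sum]; simp
    rw [hwx, hxt] at h2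
    simp_rw [mul_sub, Finset.sum_sub_distrib, ← h2, ← Finset.sum_mul, hw1, one_mul, sub_self]
  have hzero : ∀ p ∈ F, p.2 ≠ t → w p = 0 := fun p hp hne => by
    have h := (Finset.sum_eq_zero_iff_of_nonneg fun q hq =>
      mul_nonneg (hw0 q hq) (sub_nonneg.2 (hF q hq))).1 hsum p hp
    rcases mul_eq_zero.1 h with h | h
    · exact h
    · exact absurd (sub_eq_zero.1 h) hne
  have hwx' : ∑ p ∈ F.filter (fun p => p.2 = t), w p • p = x := by
    rw [Finset.sum_filter_of_ne fun p hp hne => ?_, hwx]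
    by_contra h; exact hne (by rw [hzero p hp h, zero_smul])
  have hw1' : ∑ p ∈ F.filter (fun p => p.2 = t), w p = 1 := by
    rw [Finset.sum_filter_of_ne fun p hp hne => ?_, hw1]
    by_contra h; exact hne (hzero p hp h)
  rw [← hwx']
  exact (convex_convexHull ℝ _).sum_mem (fun p hp => hw0 p (Finset.mem_of_mem_filter p hp)) hw1'
    fun p hp => subset_convexHull ℝ _ (Finset.mem_coe.2 hp)


/-! ### The recursive construction of the prism complex -/

section PrismBuild

variable [DecidableEq W] {t₀ t₁ : ℝ}

omit [NormedAddCommGroup W] [NormedSpace ℝ W] in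
/-- The bottom simplex is the image of the vertex set under the bottom lift. [folklore] -/
theorem bottomSimplex_eq_image (l : List W) : bottomSimplex t₀ l = l.toFinset.image (liftV t₀) := by
  ext p; simp [bottomSimplex]

/-- The bottom simplex of an affinely independent list is affinely independent. [folklore] -/
theorem affineIndependent_bottomSimplex {l : List W}
    (hl : AffineIndependent ℝ ((↑) : ↥l.toFinset → W)) :
    AffineIndependent ℝ ((↑) : ↥(bottomSimplex t₀ l) → W × ℝ) := by
  rw [bottomSimplex_eq_image]
  exact affineIndependent_image_liftV t₀ hl

omit [NormedAddCommGroup W] [NormedSpace ℝ W] in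
/-- Vertices of faces of the prism over `rest` at the bottom level lie in the bottom simplex of
any longer list. [folklore] -/
theorem filter_subset_bottomSimplex (ht : t₀ ≠ t₁) {v : W} {rest : List W} {F : Finset (W × ℝ)}
    (hF : F ∈ prismFaces t₀ t₁ rest) :
    F.filter (fun p => p.2 = t₀) ⊆ bottomSimplex t₀ (v :: rest) := by
  intro p hp
  obtain ⟨hpF, hpt⟩ := Finset.mem_filter.1 hp
  obtain ⟨-, i, -, hFi⟩ := hF
  obtain ⟨w, hw, h | h⟩ := exists_of_mem_stair (hFi hpF)
  · exact mem_bottomSimplex.2 ⟨w, List.mem_cons_of_mem v hw, h.symm⟩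
  · rw [h] at hpt; exact absurd hpt (ht.symm)

omit [NormedAddCommGroup W] [NormedSpace ℝ W] in
/-- Vertices of faces of a prism have level `t₀` or `t₁`, so `≥ t₀` when `t₀ ≤ t₁`. [folklore] -/
theorem le_snd_of_mem_prismFace (ht : t₀ ≤ t₁) {l : List W} {F : Finset (W × ℝ)}
    (hF : F ∈ prismFaces t₀ t₁ l) {p : W × ℝ} (hp : p ∈ F) : t₀ ≤ p.2 := by
  obtain ⟨-, i, -, hFi⟩ := hF
  obtain ⟨w, -, h | h⟩ := exists_of_mem_stair (hFi hp)
  · rw [h]; exact le_rfl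
  · rw [h]; exact ht

/-- **Union compatibility**: a face of the bottom simplex and a face of the prism over `rest`
meet in a common face. [folklore] -/
theorem bottom_inter_prism_subset (ht : t₀ < t₁) {v : W} {rest : List W}
    (hl : AffineIndependent ℝ ((↑) : ↥(v :: rest).toFinset → W)) {s t : Finset (W × ℝ)}
    (hs : s.Nonempty ∧ s ⊆ bottomSimplex t₀ (v :: rest)) (htF : t ∈ prismFaces t₀ t₁ rest) :
    convexHull ℝ (s : Set (W × ℝ)) ∩ convexHull ℝ (t : Set (W × ℝ)) ⊆
      convexHull ℝ (↑(s ∩ t) : Set (W × ℝ)) := by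
  intro x hx
  have hxt : x.2 = t₀ := snd_eq_of_mem_convexHull (fun p hp => snd_eq_of_mem_bottomSimplex (hs.2 hp)) hx.1
  have hx2 : x ∈ convexHull ℝ ((t.filter fun p => p.2 = t₀ : Finset (W × ℝ)) : Set (W × ℝ)) :=
    mem_convexHull_filter_of_snd_eq (fun p hp => le_snd_of_mem_prismFace ht.le htF hp) hx.2 hxt
  have hB := affineIndependent_bottomSimplex (t₀ := t₀) hl
  have hsub := filter_subset_bottomSimplex ht.ne (v := v) htF
  have hinter := hB.convexHull_inter hs.2 hsub
  have hx' : x ∈ convexHull ℝ (↑(s ∩ t.filter fun p => p.2 = t₀) : Set (W × ℝ)) := by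
    rw [Finset.coe_inter, hinter]; exact ⟨hx.1, hx2⟩
  exact convexHull_mono (Finset.coe_subset.2 (Finset.inter_subset_inter_left (Finset.filter_subset _ t))) hx'

/-- An affine functional equal to `1` at `v` and `0` on `rest`, for an affinely independent
`v :: rest`. [folklore] -/
theorem exists_affine_indicator {v : W} {rest : List W} (hv : v ∉ rest)
    (hl : AffineIndependent ℝ ((↑) : ↥(v :: rest).toFinset → W)) :
    ∃ β₀ : W →ᵃ[ℝ] ℝ, β₀ v = 1 ∧ ∀ w ∈ rest, β₀ w = 0 := by
  -- extend to an affine basis and take the coordinate of `v`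
  obtain ⟨t, hTt, ht, htop⟩ := exists_subset_affineIndependent_affineSpan_eq_top (k := ℝ)
    (s := ((v :: rest).toFinset : Set W)) hl
  let b : AffineBasis t ℝ W := ⟨(↑), ht, by rw [Subtype.range_coe]; exact htop⟩
  have hvt : v ∈ t := hTt (by simp)
  refine ⟨b.coord ⟨v, hvt⟩, ?_, fun w hw => ?_⟩
  · exact b.coord_apply_eq ⟨v, hvt⟩
  · have hwt : w ∈ t := hTt (by simp [hw])
    have hne : (⟨v, hvt⟩ : t) ≠ ⟨w, hwt⟩ := fun h => hv (by
      have := congrArg Subtype.val h; simp at this; rw [this]; exact hw)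
    have h := b.coord_apply_ne hne
    exact h

/-- **Visibility of the base from the new top vertex.** The union of the bottom simplex of
`v :: rest` and the prism over `rest` is visible from `(v, t₁)`: bottom faces through the level
functional, faces of the prism over `rest` through the barycentric coordinate of `v`.
[folklore] -/
theorem visibleFrom_base (ht : t₀ < t₁) {v : W} {rest : List W} (hv : v ∉ rest)
    (hl : AffineIndependent ℝ ((↑) : ↥(v :: rest).toFinset → W))
    (U : Geometry.SimplicialComplex ℝ (W × ℝ))
    (hU : U.faces = {F | F.Nonempty ∧ F ⊆ bottomSimplex t₀ (v :: rest)} ∪ prismFaces t₀ t₁ rest) :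
    VisibleFrom (liftV t₁ v) U := by
  intro τ hτ
  -- every vertex of every face is a lift of a member of `v :: rest`, at level `t₀` or `t₁`
  have hverts : ∀ τ' ∈ U.faces, ∀ p ∈ τ', ∃ w ∈ v :: rest, p = liftV t₀ w ∨ p = liftV t₁ w := by
    intro τ' hτ' p hp
    rw [hU] at hτ'
    rcases hτ' with ⟨-, hsub⟩ | hF
    · obtain ⟨w, hw, rfl⟩ := mem_bottomSimplex.1 (hsub hp)
      exact ⟨w, hw, Or.inl rfl⟩
    · obtain ⟨-, i, -, hFi⟩ := hF
      obtain ⟨w, hw, h⟩ := exists_of_mem_stair (hFi hp)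
      exact ⟨w, List.mem_cons_of_mem v hw, h⟩
  have hlevel : ∀ τ' ∈ U.faces, ∀ p ∈ τ', t₀ ≤ p.2 := by
    intro τ' hτ' p hp
    obtain ⟨w, -, h | h⟩ := hverts τ' hτ' p hp
    · rw [h]; exact le_rfl
    · rw [h]; exact ht.le
  rw [hU] at hτ
  rcases hτ with ⟨hne, hsub⟩ | hF
  · -- bottom face: the level functional
    refine ⟨-(AffineMap.snd : W × ℝ →ᵃ[ℝ] ℝ), -t₀, by simp [liftV, ht], fun x hx => ?_, fun τ' hτ' x hx => ?_⟩
    · simp only [AffineMap.coe_neg, Pi.neg_apply, AffineMap.coe_snd, neg_inj]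
      exact snd_eq_of_mem_convexHull (fun p hp => snd_eq_of_mem_bottomSimplex (hsub hp)) hx
    · simp only [AffineMap.coe_neg, Pi.neg_apply, AffineMap.coe_snd, neg_le_neg_iff]
      exact le_snd_of_mem_convexHull (hlevel τ' hτ') hx
  · -- face over `rest`: the coordinate of `v`
    obtain ⟨β₀, hβv, hβ0⟩ := exists_affine_indicator hv hl
    set fstA : W × ℝ →ᵃ[ℝ] W := (LinearMap.fst ℝ W ℝ).toAffineMap with hfstA
    have hfst : ∀ p : W × ℝ, fstA p = p.1 := fun p => rfl
    refine ⟨-(β₀.comp fstA), 0, ?_, fun x hx => ?_, fun τ' hτ' x hx => ?_⟩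
    · simp [hfst, liftV, hβv]
    · -- zero on faces over `rest`
      have hconv : Convex ℝ ((β₀.comp fstA) ⁻¹' {0}) := (convex_singleton (0:ℝ)).affine_preimage _
      have hτsub : (τ : Set (W × ℝ)) ⊆ (β₀.comp fstA) ⁻¹' {0} := fun p hp => by
        obtain ⟨-, i, -, hFi⟩ := hF
        obtain ⟨w, hw, h | h⟩ := exists_of_mem_stair (hFi (Finset.mem_coe.1 hp))
        all_goals
          rw [h]; show β₀ (fstA (liftV _ w)) ∈ ({0} : Set ℝ); rw [hfst]; exact hβ0 w hw
      have h0 := convexHull_min hτsub hconv hx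
      simp only [Set.mem_preimage, Set.mem_singleton_iff] at h0
      simp only [AffineMap.coe_neg, Pi.neg_apply, neg_eq_zero]
      exact h0
    · -- nonnegative on all faces
      have hconv : Convex ℝ ((β₀.comp fstA) ⁻¹' Set.Ici 0) := (convex_Ici (0:ℝ)).affine_preimage _
      have hτsub : (τ' : Set (W × ℝ)) ⊆ (β₀.comp fstA) ⁻¹' Set.Ici 0 := fun p hp => by
        obtain ⟨w, hw, h | h⟩ := hverts τ' hτ' p (Finset.mem_coe.1 hp)
        all_goals
          rw [h]; show β₀ (fstA (liftV _ w)) ∈ Set.Ici (0 : ℝ); rw [hfst, liftV_fst]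
          rcases List.mem_cons.1 hw with rfl | hw
          · rw [hβv]; exact Set.mem_Ici.2 zero_le_one
          · rw [hβ0 w hw]; exact Set.mem_Ici.2 le_rfl
      have h0 := convexHull_min hτsub hconv hx
      simp only [Set.mem_preimage, Set.mem_Ici] at h0
      simpa using h0

/-- **Existence of the prism complex**: for an affinely independent duplicate-free vertex list
`l` and levels `t₀ < t₁` there is a geometric simplicial complex in `W × ℝ` whose faces are
exactly the nonempty subsets of the staircase simplices — built recursively as the cone from
`(v, t₁)` over the union of the bottom simplex and the prism over the remaining vertices.
[cite: RourkeSanderson1972, Ch. 2 (cones) and the standard triangulation of a prism] -/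
theorem exists_prismComplex (ht : t₀ < t₁) :
    ∀ (l : List W), l.Nodup → AffineIndependent ℝ ((↑) : ↥l.toFinset → W) →
      ∃ K : Geometry.SimplicialComplex ℝ (W × ℝ), K.faces = prismFaces t₀ t₁ l
  | [], _, _ => ⟨⊥, by
      ext F; simp [Geometry.SimplicialComplex.faces_bot, prismFaces]⟩
  | v :: rest, hnd, hind => by
      obtain ⟨hv, hnd'⟩ := List.nodup_cons.1 hnd
      have hind' : AffineIndependent ℝ ((↑) : ↥rest.toFinset → W) :=
        hind.mono (by intro w hw; simp at hw ⊢; exact Or.inr hw)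
      obtain ⟨Krest, hK⟩ := exists_prismComplex ht rest hnd' hind'
      -- the bottom simplex and the union with the prism over `rest`
      let Bcx := simplexCx (bottomSimplex t₀ (v :: rest)) (affineIndependent_bottomSimplex hind)
      have hcompat : ∀ s ∈ Bcx.faces, ∀ t ∈ Krest.faces,
          convexHull ℝ (s : Set (W × ℝ)) ∩ convexHull ℝ (t : Set (W × ℝ)) ⊆
            convexHull ℝ (↑(s ∩ t) : Set (W × ℝ)) := fun s hs t htK =>
        bottom_inter_prism_subset ht hind hs (hK ▸ htK)
      let U := unionComplex Bcx Krest hcompat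
      have hU : U.faces = {F | F.Nonempty ∧ F ⊆ bottomSimplex t₀ (v :: rest)} ∪ prismFaces t₀ t₁ rest := by
        rw [unionComplex_faces, simplexCx_faces, hK]
      have hvis : VisibleFrom (liftV t₁ v) U := visibleFrom_base ht hv hind U hU
      refine ⟨coneComplex (liftV t₁ v) U hvis, ?_⟩
      rw [coneComplex_faces, hU, prismFaces_cons ht.ne hv]


/-! ### Coverage: the staircase simplices fill the prism -/

omit [DecidableEq W] in
/-- **Ray casting from the top vertex.** Let `D` be convex and nonempty, `C = conv ({v} ∪ D)`,
`a = (v, t₁)` and `t₀ < t₁`.  Every point of `C × [t₀, t₁]` other than `a` lies on a segment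
from `a` to a point of the *base* `C × {t₀} ∪ D × [t₀, t₁]` (every convex polytope is the cone
from a vertex over the complementary boundary). [folklore] -/
theorem exists_mem_base_mem_segment (ht : t₀ < t₁) {v : W} {D : Set W} (hD : Convex ℝ D)
    (hDne : D.Nonempty) {x : W} (hx : x ∈ convexHull ℝ (insert v D)) {s : ℝ} (hs : s ∈ Set.Icc t₀ t₁) :
    (x, s) = liftV t₁ v ∨ ∃ q : W × ℝ,
      ((q.1 ∈ convexHull ℝ (insert v D) ∧ q.2 = t₀) ∨ (q.1 ∈ D ∧ q.2 ∈ Set.Icc t₀ t₁)) ∧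
        (x, s) ∈ segment ℝ (liftV t₁ v) q := by
  rw [convexHull_insert hDne, hD.convexHull_eq, convexJoin_singleton_left] at hx
  obtain ⟨y, hy, hxy⟩ := Set.mem_iUnion₂.1 hx
  obtain ⟨μ, hμ, rfl⟩ := (segment_eq_image ℝ v y ▸ hxy :
    x ∈ (fun θ : ℝ => (1 - θ) • v + θ • y) '' Set.Icc 0 1)
  set δ := t₁ - s with hδ
  have hδ0 : 0 ≤ δ := by rw [hδ]; linarith [hs.2]
  have hδ1 : δ ≤ t₁ - t₀ := by rw [hδ]; linarith [hs.1]
  have hT : 0 < t₁ - t₀ := sub_pos.2 ht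
  have hyC : ∀ κ ∈ Set.Icc (0:ℝ) 1, (1 - κ) • v + κ • y ∈ convexHull ℝ (insert v D) := fun κ hκ => by
    rw [convexHull_insert hDne, hD.convexHull_eq, convexJoin_singleton_left]
    exact Set.mem_iUnion₂.2 ⟨y, hy, ⟨1 - κ, κ, by linarith [hκ.2], hκ.1, by ring, rfl⟩⟩
  by_cases hcase : δ ≤ μ * (t₁ - t₀)
  · rcases hμ.1.eq_or_lt with hμ0 | hμ0
    · -- `μ = 0` forces `δ = 0`: the point is the apex
      left
      rw [← hμ0] at hcase
      have hδ00 : δ = 0 := le_antisymm (by simpa using hcase) hδ0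
      have hs1 : s = t₁ := by rw [hδ] at hδ00; linarith
      rw [← hμ0, hs1]; simp [liftV]
    · -- wall point `(y, t₁ - δ/μ)`, parameter `μ`
      right
      refine ⟨(y, t₁ - δ / μ), Or.inr ⟨hy, ?_, ?_⟩, ?_⟩
      · show t₀ ≤ t₁ - δ / μ
        have : δ / μ ≤ t₁ - t₀ := by rw [div_le_iff₀ hμ0]; linarith [mul_comm μ (t₁ - t₀)]
        linarith
      · show t₁ - δ / μ ≤ t₁
        have : 0 ≤ δ / μ := div_nonneg hδ0 hμ0.le
        linarith
      · refine ⟨1 - μ, μ, by linarith [hμ.2], hμ.1, by ring, ?_⟩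
        rw [liftV]
        ext
        · simp [Prod.smul_mk]
        · simp only [Prod.smul_mk, Prod.mk_add_mk, smul_eq_mul]
          rw [hδ]; field_simp; ring
  · -- bottom point `(v + (μ(t₁-t₀)/δ)(y - v), t₀)`, parameter `δ/(t₁-t₀)`
    push Not at hcase
    have hμ0' : 0 ≤ μ := hμ.1
    have hδpos : 0 < δ := lt_of_le_of_lt (mul_nonneg hμ.1 hT.le) hcase
    set κ := μ * (t₁ - t₀) / δ with hκ
    have hκ0 : 0 ≤ κ := by rw [hκ]; positivity
    have hκ1 : κ ≤ 1 := by rw [hκ, div_le_one hδpos]; exact hcase.le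
    right
    refine ⟨((1 - κ) • v + κ • y, t₀), Or.inl ⟨hyC κ ⟨hκ0, hκ1⟩, rfl⟩, ?_⟩
    refine ⟨1 - δ / (t₁ - t₀), δ / (t₁ - t₀), by rw [sub_nonneg, div_le_one hT]; exact hδ1,
      by positivity, by ring, ?_⟩
    have hκδ : δ / (t₁ - t₀) * κ = μ := by
      rw [hκ]; field_simp
    rw [liftV]
    ext
    · simp only [Prod.smul_mk, Prod.mk_add_mk, smul_add, smul_smul]
      rw [hκδ]
      have : (1 - δ / (t₁ - t₀)) • v + (δ / (t₁ - t₀) * (1 - κ)) • v = (1 - μ) • v := by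
        rw [← add_smul]; congr 1; rw [mul_sub, mul_one, hκδ]; ring
      rw [← add_assoc, this]
    · simp only [Prod.smul_mk, Prod.mk_add_mk, smul_eq_mul]
      rw [hδ]; field_simp; ring


/-- **The prism** over the vertex list `l` between the levels `t₀, t₁`. [folklore] -/
def prismSet (t₀ t₁ : ℝ) (l : List W) : Set (W × ℝ) :=
  {p | p.1 ∈ convexHull ℝ (l.toFinset : Set W) ∧ p.2 ∈ Set.Icc t₀ t₁}

/-- Segments from the apex to a closed simplex lie in the cone simplex. [folklore] -/
theorem segment_subset_convexHull_insert {a q : W × ℝ} {τ : Finset (W × ℝ)}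
    (hq : q ∈ convexHull ℝ (τ : Set (W × ℝ))) :
    segment ℝ a q ⊆ convexHull ℝ (↑(insert a τ) : Set (W × ℝ)) := by
  rw [Finset.coe_insert]
  exact (convex_convexHull ℝ _).segment_subset (subset_convexHull ℝ _ (Set.mem_insert a _))
    (convexHull_mono (Set.subset_insert a _) hq)

/-- The closed bottom simplex is the bottom copy of the closed simplex. [folklore] -/
theorem mem_convexHull_bottomSimplex {l : List W} {q : W × ℝ}
    (hq1 : q.1 ∈ convexHull ℝ (l.toFinset : Set W)) (hq2 : q.2 = t₀) :
    q ∈ convexHull ℝ (bottomSimplex t₀ l : Set (W × ℝ)) := by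
  obtain ⟨f, hf⟩ := exists_affineMap_liftV (W := W) t₀
  have himg : (bottomSimplex t₀ l : Set (W × ℝ)) = f '' (l.toFinset : Set W) := by
    ext p
    simp only [mem_bottomSimplex, Set.mem_image, Finset.mem_coe, List.mem_toFinset, hf]
  rw [himg, ← AffineMap.image_convexHull]
  refine ⟨q.1, hq1, ?_⟩
  rw [hf, liftV]
  exact Prod.ext rfl hq2.symm

/-- **The staircase simplices fill the prism**: the union of the closed simplices of the prism
faces over a duplicate-free list is exactly `conv l × [t₀, t₁]`. [folklore] -/
theorem iUnion_prismFaces_eq (ht : t₀ < t₁) :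
    ∀ l : List W, l.Nodup →
      ⋃ F ∈ prismFaces t₀ t₁ l, convexHull ℝ (F : Set (W × ℝ)) = prismSet t₀ t₁ l
  | [], _ => by
      ext p
      simp [prismFaces, prismSet]
  | v :: rest, hnd => by
      obtain ⟨hv, hnd'⟩ := List.nodup_cons.1 hnd
      have IH := iUnion_prismFaces_eq ht rest hnd'
      set a := liftV t₁ v with ha
      apply Set.Subset.antisymm
      · -- faces have their vertices, hence their hulls, in the convex prism
        refine Set.iUnion₂_subset fun F hF => ?_
        have hconv : Convex ℝ (prismSet t₀ t₁ (v :: rest)) := by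
          have : prismSet t₀ t₁ (v :: rest) =
              (LinearMap.fst ℝ W ℝ) ⁻¹' convexHull ℝ ((v :: rest).toFinset : Set W) ∩
                (LinearMap.snd ℝ W ℝ) ⁻¹' Set.Icc t₀ t₁ := by
            ext p; simp [prismSet]
          rw [this]
          exact ((convex_convexHull ℝ _).linear_preimage _).inter ((convex_Icc t₀ t₁).linear_preimage _)
        refine convexHull_min (fun p hp => ?_) hconv
        obtain ⟨-, i, -, hFi⟩ := hF
        obtain ⟨w, hw, h | h⟩ := exists_of_mem_stair (hFi (Finset.mem_coe.1 hp))
        all_goals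
          rw [h]
          refine ⟨subset_convexHull ℝ _ (by simpa using hw), ?_⟩
          simp [liftV, ht.le]
      · -- ray casting from `a`
        intro p hp
        obtain ⟨hp1, hp2⟩ := hp
        have hbot_face : bottomSimplex t₀ (v :: rest) ∈ prismFaces t₀ t₁ (v :: rest) := by
          rw [prismFaces_cons ht.ne hv]
          exact Or.inl (Or.inl (Or.inl ⟨⟨liftV t₀ v, mem_bottomSimplex.2 ⟨v, by simp, rfl⟩⟩,
            Finset.Subset.rfl⟩))
        have hcone_face : ∀ τ, (τ ∈ {F : Finset (W × ℝ) | F.Nonempty ∧ F ⊆ bottomSimplex t₀ (v :: rest)} ∨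
            τ ∈ prismFaces t₀ t₁ rest) → insert a τ ∈ prismFaces t₀ t₁ (v :: rest) := fun τ hτ => by
          rw [prismFaces_cons ht.ne hv]
          exact Or.inl (Or.inr ⟨τ, hτ, rfl⟩)
        -- membership in the union through a cone face over a base face `τ` containing `q`
        have hconclude : ∀ (τ : Finset (W × ℝ)) (q : W × ℝ),
            (τ ∈ {F : Finset (W × ℝ) | F.Nonempty ∧ F ⊆ bottomSimplex t₀ (v :: rest)} ∨
              τ ∈ prismFaces t₀ t₁ rest) →
            q ∈ convexHull ℝ (τ : Set (W × ℝ)) → p ∈ segment ℝ a q →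
            p ∈ ⋃ F ∈ prismFaces t₀ t₁ (v :: rest), convexHull ℝ (F : Set (W × ℝ)) :=
          fun τ q hτ hq hpq => Set.mem_iUnion₂.2 ⟨insert a τ, hcone_face τ hτ,
            segment_subset_convexHull_insert hq hpq⟩
        have hbotτ : bottomSimplex t₀ (v :: rest) ∈
            {F : Finset (W × ℝ) | F.Nonempty ∧ F ⊆ bottomSimplex t₀ (v :: rest)} :=
          ⟨⟨liftV t₀ v, mem_bottomSimplex.2 ⟨v, by simp, rfl⟩⟩, Finset.Subset.rfl⟩
        by_cases hnil : rest = []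
        · -- a point over the single vertex `v`: on the vertical segment
          subst hnil
          have hx : p.1 = v := by
            have h := hp1
            simp only [List.toFinset_cons, List.toFinset_nil, insert_empty_eq, Finset.coe_singleton,
              convexHull_singleton, Set.mem_singleton_iff] at h
            exact h
          have hq : (liftV t₀ v) ∈ convexHull ℝ (bottomSimplex t₀ [v] : Set (W × ℝ)) :=
            subset_convexHull ℝ _ (Finset.mem_coe.2 (mem_bottomSimplex.2 ⟨v, by simp, rfl⟩))
          refine hconclude _ _ (Or.inl hbotτ) hq ?_
          have hT : 0 < t₁ - t₀ := sub_pos.2 ht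
          refine ⟨(p.2 - t₀) / (t₁ - t₀), (t₁ - p.2) / (t₁ - t₀), div_nonneg (by linarith [hp2.1]) hT.le,
            div_nonneg (by linarith [hp2.2]) hT.le, by field_simp; ring, ?_⟩
          rw [ha, liftV, liftV]
          ext
          · simp only [Prod.smul_mk, Prod.mk_add_mk, ← add_smul, hx]
            rw [show (p.2 - t₀) / (t₁ - t₀) + (t₁ - p.2) / (t₁ - t₀) = 1 from by field_simp; ring, one_smul]
          · simp only [Prod.smul_mk, Prod.mk_add_mk, smul_eq_mul]
            field_simp; ring
        · -- ray casting over `conv (v :: rest) = conv ({v} ∪ conv rest)`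
          set D : Set W := convexHull ℝ (rest.toFinset : Set W) with hD
          have hDne : D.Nonempty := by
            obtain ⟨w, hw⟩ := List.exists_mem_of_ne_nil rest hnil
            exact ⟨w, subset_convexHull ℝ _ (by simpa using hw)⟩
          have hCD : convexHull ℝ (insert v D) = convexHull ℝ ((v :: rest).toFinset : Set W) := by
            rw [hD, Set.insert_eq, convexHull_convexHull_union_right, ← Set.insert_eq,
              List.toFinset_cons, Finset.coe_insert]
          have hx : p.1 ∈ convexHull ℝ (insert v D) := by rw [hCD]; exact hp1
          rcases exists_mem_base_mem_segment ht (convex_convexHull ℝ _) hDne hx hp2 with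
            hpa | ⟨q, hq, hpq⟩
          · refine Set.mem_iUnion₂.2 ⟨{a}, ?_, ?_⟩
            · rw [prismFaces_cons ht.ne hv]; exact Or.inr (Set.mem_singleton _)
            · rw [Finset.coe_singleton, convexHull_singleton]
              exact hpa
          · rcases hq with ⟨hq1, hq2⟩ | ⟨hq1, hq2⟩
            · rw [hCD] at hq1
              exact hconclude _ q (Or.inl hbotτ) (mem_convexHull_bottomSimplex hq1 hq2) hpq
            · have hqU : q ∈ prismSet t₀ t₁ rest := ⟨hq1, hq2⟩
              rw [← IH] at hqU
              obtain ⟨τ, hτ, hqτ⟩ := Set.mem_iUnion₂.1 hqU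
              exact hconclude τ q (Or.inr hτ) hqτ hpq

end PrismBuild


end PrismGeom

end Literature.Topology.FourManifolds
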